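import Summits.CriticalPhenomena.CardyFormulaZ2.Theses.CardyUSTContinuation
import Summits.CriticalPhenomena.CardyFormulaZ2.Theorems.CardyUSTContinuationUniformAnalyticExtensionStubRatioToCrux
import Summits.CriticalPhenomena.CardyFormulaZ2.Theorems.CardyUSTContinuationUniformAnalyticExtensionDerivativeBounds
import Summits.CriticalPhenomena.CardyFormulaZ2.Theorems.CardyUSTContinuationUniformAnalyticExtensionTightness
import Summits.CriticalPhenomena.CardyFormulaZ2.Theorems.CardyUSTContinuationUniformAnalyticExtensionStubDerivBoundsToRatioBound
import Literature.Probability.LatticeModels.FKTwoArcPartitionPolynomials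
import HarnessLib

/-!
# The crux `UniformAnalyticExtension` IS a real-axis statement: unconditional tightness of the
# real-axis cut (stmt-CriticalPhenomena-6047, route `CardyUSTContinuation`, line `registered`,
# skeleton v8.1, lead c7)

Write `Z_δ = fkTwoArcPartitionPolynomials R δ .joint`, `N_δ = fkTwoArcCrossingPolynomial R δ .joint`
(`u_R(t, δ) = N_δ(t)/Z_δ(t)` for `t, δ > 0`) and `f_δ z = N_δ(z)/Z_δ(z)` for the junk-valued rational
function on `ℂ`.  Three normal forms of the crux are now certified EQUIVALENT, with no appeal to the
sibling crux X_S (unlike the value-distribution form of skeleton v7, p163530):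

* (crux)  δ-uniform bounded analytic extensions of `u_R(·, δ)|[t₁,1]` to a complex neighbourhood;
* (RB)    `Sig.ratioBound`: a δ-uniform bound of `f_δ` on a complex `ρ`-neighbourhood of `[t₁,1]`;
* (DB)    `Sig.stub_derivBounds` (the ONE open stub of skeleton v8.1): δ-uniform Gevrey-1 bounds
          `‖f_δ^{(k)}(t)‖ ≤ M·k!/rᵏ` for all orders `k` at the REAL points `t ∈ [t₁, 1]`.

`realAxis_crux_iff_derivBounds : crux ↔ (DB)` — `⇒` is Cauchy's inequalities (`crux_derivBounds`,
p163846), `⇐` is the landed engine `stub_derivBoundsToRatioBound` (p167276: Taylor series at the real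
points + identity theorem) followed by the landed normal form `stub_ratioToCrux` (p145290, Riemann's
removable singularities).  `realAxis_ratioBound_iff_derivBounds : (RB) ↔ (DB)` closes the triangle, and
`realAxis_derivBounds_of_ratioOmits` records that v7's value-distribution stub implies (DB).

Reading of (DB): along the self-dual line `(t∂_t)^k u_R(t,δ)` is the joint cumulant, under the critical
FK measure, of the crossing indicator with `k` copies of `H(ω) = |ω| + 2k^joint(ω)`; by Euler's formula
`H = k^joint(ω) + k^sep(ω*) + const` (primal plus dual cluster count = number of loops + const), so the
crux is EXACTLY: δ-uniform factorial bounds, locally uniform in `t ∈ [t₁,1]`, on all joint cumulants of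
the crossing indicator with the loop count — a statement about the lattice model on the real critical
segment only (lead c7's probe (P1) tests order 1 at the percolation end by Monte Carlo).
-/

noncomputable section

open Filter Topology Set Polynomial Metric
open Literature.Probability.LatticeModels
open Literature.Probability.RandomPlanarGeometry (ConformalRectangle)

namespace Summit.CriticalPhenomena.CardyFormulaZ2.Cruxes.UniformAnalyticExtension.Birth

/-- **The crux is equivalent to δ-uniform Gevrey-1 bounds on the real segment** (unconditional):
`UniformAnalyticExtension ↔ ∀ R, ∀ t₁ ∈ (0,1), ∃ r > 0, ∃ M, ∀ᶠ δ → 0⁺, ∀ k, ∀ t ∈ [t₁,1],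
‖(N_δ/Z_δ)^{(k)}(t)‖ ≤ M·k!/rᵏ`.  `⇒`: Cauchy's inequalities for the bounded extension (p163846);
`⇐`: Taylor series at the real points (engine p167276) and removable singularities (p145290).
[folklore] -/
theorem realAxis_crux_iff_derivBounds :
    Summit.CriticalPhenomena.CardyFormulaZ2.Theses.CardyUSTContinuation.UniformAnalyticExtension ↔
    ∀ R : ConformalRectangle, ∀ t₁ ∈ Set.Ioo (0:ℝ) 1, ∃ r > (0:ℝ), ∃ M : ℝ, ∀ᶠ δ in 𝓝[>] (0:ℝ),
      ∀ k : ℕ, ∀ t ∈ Set.Icc t₁ 1,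
        ‖iteratedDeriv k (fun z : ℂ => aeval z (fkTwoArcCrossingPolynomial R δ ArcWiring.joint) /
            aeval z (fkTwoArcPartitionPolynomials R δ ArcWiring.joint)) (t : ℂ)‖ ≤
          M * k.factorial / r ^ k :=
  ⟨crux_derivBounds, fun hD => stub_ratioToCrux (stub_derivBoundsToRatioBound hD)⟩

/-- **The two normal forms agree**: a δ-uniform bound of the junk-valued ratio `N_δ/Z_δ` on a complex
neighbourhood of `[t₁,1]` (the normal form of skeleton v3, c1–c3) is equivalent to δ-uniform Gevrey-1
bounds at the real points (skeleton v8). [folklore] -/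
theorem realAxis_ratioBound_iff_derivBounds :
    (∀ R : ConformalRectangle, ∀ t₁ ∈ Set.Ioo (0:ℝ) 1, ∃ ρ > (0:ℝ), ∃ M : ℝ, ∀ᶠ δ in 𝓝[>] (0:ℝ),
      ∀ z ∈ thickening ρ (((↑) : ℝ → ℂ) '' Set.Icc t₁ 1),
        ‖aeval z (fkTwoArcCrossingPolynomial R δ ArcWiring.joint) /
            aeval z (fkTwoArcPartitionPolynomials R δ ArcWiring.joint)‖ ≤ M) ↔
    ∀ R : ConformalRectangle, ∀ t₁ ∈ Set.Ioo (0:ℝ) 1, ∃ r > (0:ℝ), ∃ M : ℝ, ∀ᶠ δ in 𝓝[>] (0:ℝ),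
      ∀ k : ℕ, ∀ t ∈ Set.Icc t₁ 1,
        ‖iteratedDeriv k (fun z : ℂ => aeval z (fkTwoArcCrossingPolynomial R δ ArcWiring.joint) /
            aeval z (fkTwoArcPartitionPolynomials R δ ArcWiring.joint)) (t : ℂ)‖ ≤
          M * k.factorial / r ^ k :=
  ⟨fun hRB => crux_derivBounds (stub_ratioToCrux hRB), stub_derivBoundsToRatioBound⟩

/-- **v7 ⇒ v8**: the value-distribution stub of skeleton v7 ("`N_δ = h·Z_δ` on a δ-uniform complex
neighbourhood with `h` holomorphic omitting `0` and `1`") implies the real-axis stub of skeleton v8,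
through the landed Schottky composition (p163530) and Cauchy's inequalities. [folklore] -/
theorem realAxis_derivBounds_of_ratioOmits
    (hO : ∀ R : ConformalRectangle, ∀ t₁ ∈ Set.Ioo (0:ℝ) 1, ∃ ρ > (0:ℝ), ∀ᶠ δ in 𝓝[>] (0:ℝ),
      ∃ h : ℂ → ℂ, DifferentiableOn ℂ h (thickening ρ (((↑) : ℝ → ℂ) '' Set.Icc t₁ 1)) ∧
        (∀ z ∈ thickening ρ (((↑) : ℝ → ℂ) '' Set.Icc t₁ 1), h z ≠ 0 ∧ h z ≠ 1) ∧
        ∀ z ∈ thickening ρ (((↑) : ℝ → ℂ) '' Set.Icc t₁ 1),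
          aeval z (fkTwoArcCrossingPolynomial R δ ArcWiring.joint) =
            h z * aeval z (fkTwoArcPartitionPolynomials R δ ArcWiring.joint)) :
    ∀ R : ConformalRectangle, ∀ t₁ ∈ Set.Ioo (0:ℝ) 1, ∃ r > (0:ℝ), ∃ M : ℝ, ∀ᶠ δ in 𝓝[>] (0:ℝ),
      ∀ k : ℕ, ∀ t ∈ Set.Icc t₁ 1,
        ‖iteratedDeriv k (fun z : ℂ => aeval z (fkTwoArcCrossingPolynomial R δ ArcWiring.joint) /
            aeval z (fkTwoArcPartitionPolynomials R δ ArcWiring.joint)) (t : ℂ)‖ ≤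
          M * k.factorial / r ^ k :=
  crux_derivBounds (tightness_crux_of_ratioOmits hO)

/-- **Order one at the percolation end, from the real-axis stub directly** (no detour through the
crux): δ-uniform Gevrey bounds give in particular a δ-uniform bound of the first `t`-derivative of the
crossing ratio at `t = 1`, i.e. of `Cov_δ(1_cross, |ω| + 2k^joint(ω))` under Bernoulli(1/2) bond
percolation of `Ω_δ` — the quantity lead c7's Monte-Carlo probe (P1) measures. [folklore] -/
theorem realAxis_derivBounds_one
    (hD : ∀ R : ConformalRectangle, ∀ t₁ ∈ Set.Ioo (0:ℝ) 1, ∃ r > (0:ℝ), ∃ M : ℝ, ∀ᶠ δ in 𝓝[>] (0:ℝ),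
      ∀ k : ℕ, ∀ t ∈ Set.Icc t₁ 1,
        ‖iteratedDeriv k (fun z : ℂ => aeval z (fkTwoArcCrossingPolynomial R δ ArcWiring.joint) /
            aeval z (fkTwoArcPartitionPolynomials R δ ArcWiring.joint)) (t : ℂ)‖ ≤
          M * k.factorial / r ^ k) :
    ∀ R : ConformalRectangle, ∃ C : ℝ, ∀ᶠ δ in 𝓝[>] (0:ℝ),
      ‖deriv (fun z : ℂ => aeval z (fkTwoArcCrossingPolynomial R δ ArcWiring.joint) /
          aeval z (fkTwoArcPartitionPolynomials R δ ArcWiring.joint)) 1‖ ≤ C :=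
  crux_derivBounds_one (realAxis_crux_iff_derivBounds.2 hD)

end Summit.CriticalPhenomena.CardyFormulaZ2.Cruxes.UniformAnalyticExtension.Birth
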